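import Summits.CriticalPhenomena.PercolationContinuityZ3.Theorems.PercNearOneGluingNoHeavyQuantWindowAtomsExtreme
import Summits.CriticalPhenomena.PercolationContinuityZ3.Theorems.PercNearOneGluingNoHeavyQuantSDEC
import Mathlib.Analysis.Convex.Caratheodory
import Mathlib.LinearAlgebra.AffineSpace.FiniteDimensional
import Mathlib.Topology.Maps.Proper.Basic
import HarnessLib

/-!
# QUANT lane R8, T-DEC: DEC AND SDEC PASS TO LIMITS — the genericity principle for certificate families

builds on p205010 (kernel theorem, internal audit signed; external expert review pending)

Support file (`--supports stmt-CriticalPhenomena-4575`), QUANT lane lead seat prim-quant-lead (gen 43), rung R8 of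
`run/shared/lean/prim/quant/LADDER.md`.  Two auxiliary definitions (`LawDec.tpVec`, `LawDec.ValidC`), theorems with standard axioms, no sorries.

WHY (README V401–V403, lead g43).  Every certificate family of the light half (count-level re-gating mixtures RCM, the pattern identities of
arm-1 g45 / census-2 g70, the lead's families) meets TIED configurations — several siblings carrying the floor, `S = R_U` coincidences, equal
root gates — where the generic certificate degenerates (README V394 '21 not found — ALL tied', V398′, RPM3-G70 §1 'pinning').  This file removes
them from the agenda: **DEC at an explicit target is a CLOSED condition jointly in (floor, target, law)**, hence so is SDEC in (floor, law); so in any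
induction step whose data vary continuously with the gate parameters of a fixed forest shape (e.g. `LawDec.GateStepN`) it suffices to prove the
conclusion on a DENSE set of parameters — ties and every other nowhere-dense coincidence locus may be assumed absent.

* `LawDec.tpVec`, `LawDec.ValidC` (`validC_iff`: `= ValidAt` for `x < 1`, the light credit line multiplied through by `1 − x`);
  `LawDec.decAtT_iff_boundedDecomposition` (DEC(j′) on `{0..M}` iff a decomposition with ≤ `M + 2` components — Carathéodory in `ℝ^{M+1}`);
  `LawDec.isClosed_decGraph` (the graph `{((x,T), v)}` of DEC(j′) is closed: projection of a closed relation along the compact parameter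
  space `stdSimplex × [0,1]^{M+2}`, finitely many size patterns).
* **`LawDec.decAtT_of_tendsto`**, `LawDec.decAt_of_tendsto`, **`LawDec.sdec_of_tendsto`** (`xₙ → x < 1`, `Tₙ → T`, `μₙ → μ` pointwise, laws
  vanishing above `M`: DEC(j′) / SDEC of every `μₙ` ⟹ of `μ`), `LawDec.sdec_of_forall_lt` (SDEC at every floor `< x` ⟹ at `x`).

HONEST STATUS: tools only; `GateStepN`, `FarTreeRow` and the RATE class (log\*) are unchanged.
[this work]; Carathéodory [folklore, Mathlib `eq_pos_convex_span_of_mem_convexHull`]; closed projections along compact factors [folklore, Mathlib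
`isClosedMap_fst_of_compactSpace`].  The gluing rows served [cite: KozmaNitzan2024, Conjecture 3 (p. 15)]; product measure [cite: Grimmett1999, §1.3 p. 10].
-/

noncomputable section

namespace Summit.CriticalPhenomena.PercolationContinuityZ3.Theorems

namespace Quant

open Finset Filter Topology

namespace LawDec

/-! ### Two-point vectors and the closed form of validity -/

/-- the two-point law `{lo, hi; g}` as a coordinate vector on `{0..M}`: `g·[i = hi] + (1−g)·[i = lo]`. [this work] -/
def tpVec (M lo hi : ℕ) (g : ℝ) : Fin (M + 1) → ℝ :=
  fun i => g * (if (i : ℕ) = hi then 1 else 0) + (1 - g) * (if (i : ℕ) = lo then 1 else 0)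

/-- **closed form of validity**: `ValidAt` with the light credit line multiplied through by `1 − x` (no division), so that it is a closed
condition in `(x, T, g)`. [this work] -/
def ValidC (x T : ℝ) (j' lo hi : ℕ) (g : ℝ) : Prop :=
  (lo = hi ∧ (T ≤ 2 * (lo : ℝ) ∨ j' + 1 ≤ lo)) ∨
  (lo < hi ∧ j' + 1 ≤ hi ∧ x ≤ g) ∨
  (lo < hi ∧ hi ≤ j' ∧ (1 - x) * T ≤ (1 - x) * (2 * (lo : ℝ)) + ((hi : ℝ) - lo) * (if x ≤ g then g * (1 - x) else g - x ^ 2))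

/-- `ValidC ↔ ValidAt` for floors `x < 1`. [this work] -/
theorem validC_iff {x T : ℝ} {j' lo hi : ℕ} {g : ℝ} (hx1 : x < 1) : ValidC x T j' lo hi g ↔ ValidAt x T j' lo hi g := by
  have hx : 0 < 1 - x := by linarith
  have key : (1 - x) * T ≤ (1 - x) * (2 * (lo : ℝ)) + ((hi : ℝ) - lo) * (if x ≤ g then g * (1 - x) else g - x ^ 2) ↔
      T ≤ 2 * (lo : ℝ) + ((hi : ℝ) - lo) * (if x ≤ g then g else (g - x ^ 2) / (1 - x)) := by
    split_ifs with hxg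
    · constructor
      · intro h; nlinarith
      · intro h; nlinarith
    · have e : ((hi : ℝ) - lo) * ((g - x ^ 2) / (1 - x)) = (((hi : ℝ) - lo) * (g - x ^ 2)) / (1 - x) := by ring
      rw [e]
      constructor
      · intro h
        have : (1 - x) * T - (1 - x) * (2 * (lo : ℝ)) ≤ ((hi : ℝ) - lo) * (g - x ^ 2) := by linarith
        have h2 : T - 2 * (lo : ℝ) ≤ ((hi : ℝ) - lo) * (g - x ^ 2) / (1 - x) := by
          rw [le_div_iff₀ hx]; nlinarith
        linarith
      · intro h
        have h2 : T - 2 * (lo : ℝ) ≤ ((hi : ℝ) - lo) * (g - x ^ 2) / (1 - x) := by linarith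
        rw [le_div_iff₀ hx] at h2; nlinarith
  unfold ValidC ValidAt
  rw [key]

/-! ### DEC(j′) ⟺ a decomposition with at most `M + 2` components (Carathéodory) -/

/-- the set of valid two-point vectors at `(x, T, j′)` on `{0..M}`. [this work] -/
def validSet (x T : ℝ) (j' M : ℕ) : Set (Fin (M + 1) → ℝ) :=
  {v | ∃ (lo hi : ℕ) (g : ℝ), lo ≤ hi ∧ hi ≤ M ∧ 0 ≤ g ∧ g ≤ 1 ∧ ValidAt x T j' lo hi g ∧ v = tpVec M lo hi g}

/-- DEC(j′) at target `T` puts the law's coordinate vector in the convex hull of the valid two-point vectors. [this work] -/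
theorem mem_convexHull_validSet_of_decAtT {x T : ℝ} {j' M : ℕ} {μ : ℕ → ℝ} (h : DECAtT x T j' M μ) :
    (fun i : Fin (M + 1) => μ i) ∈ convexHull ℝ (validSet x T j' M) := by
  classical
  obtain ⟨ρ, hρ, lam, g, lo, hi, h0, h1, hg, hlohi, hhi, hμ, hval⟩ := h
  set s := Finset.univ.filter (fun r : ρ => 0 < lam r) with hs
  have hzero : ∀ r, ¬ 0 < lam r → lam r = 0 := fun r hr => le_antisymm (not_lt.mp hr) (h0 r)
  have hsum1 : ∑ r ∈ s, lam r = 1 := by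
    rw [hs, Finset.sum_filter]
    rw [← h1]
    refine Finset.sum_congr rfl fun r _ => ?_
    by_cases hr : 0 < lam r
    · rw [if_pos hr]
    · rw [if_neg hr, hzero r hr]
  have hvec : (fun i : Fin (M + 1) => μ i) = ∑ r ∈ s, lam r • tpVec M (lo r) (hi r) (g r) := by
    funext i
    rw [Finset.sum_apply, hμ i, hs, Finset.sum_filter]
    refine Finset.sum_congr rfl fun r _ => ?_
    by_cases hr : 0 < lam r
    · rw [if_pos hr]; simp only [Pi.smul_apply, smul_eq_mul, tpVec]
    · rw [if_neg hr, hzero r hr]; ring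
  rw [hvec]
  refine (convex_convexHull ℝ (validSet x T j' M)).sum_mem (fun r _ => h0 r) hsum1 fun r hr => ?_
  have hr' : 0 < lam r := (Finset.mem_filter.1 hr).2
  exact subset_convexHull ℝ _ ⟨lo r, hi r, g r, hlohi r, hhi r, (hg r).1, (hg r).2, hval r hr', rfl⟩

/-- **Carathéodory**: a vector in the convex hull of the valid two-point vectors is a convex combination of at most `M + 2` of them —
written with exactly `M + 2` slots (zero weights allowed; every slot has `lo ≤ hi ≤ M`, `g ∈ [0,1]`, and the charged slots are valid). [this work] -/
theorem exists_boundedDecomposition_of_mem_convexHull {x T : ℝ} {j' M : ℕ} {v : Fin (M + 1) → ℝ}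
    (hv : v ∈ convexHull ℝ (validSet x T j' M)) :
    ∃ (w gg : Fin (M + 2) → ℝ) (lo hi : Fin (M + 2) → ℕ),
      (∀ r, 0 ≤ w r) ∧ ∑ r, w r = 1 ∧ (∀ r, 0 ≤ gg r ∧ gg r ≤ 1) ∧ (∀ r, lo r ≤ hi r ∧ hi r ≤ M) ∧
      (∀ r, 0 < w r → ValidAt x T j' (lo r) (hi r) (gg r)) ∧ v = ∑ r, w r • tpVec M (lo r) (hi r) (gg r) := by
  classical
  obtain ⟨ι, _inst, z, w, hz, hai, hwpos, hw1, hwv⟩ := eq_pos_convex_span_of_mem_convexHull hv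
  have hcard : Fintype.card ι ≤ M + 2 := by
    have h1 := hai.card_le_finrank_succ.trans (Nat.add_le_add_right (Submodule.finrank_le _) 1)
    rw [Module.finrank_fin_fun] at h1
    omega
  -- data of each point
  have hdat : ∀ i, ∃ (lo hi : ℕ) (g : ℝ), lo ≤ hi ∧ hi ≤ M ∧ 0 ≤ g ∧ g ≤ 1 ∧ ValidAt x T j' lo hi g ∧ z i = tpVec M lo hi g :=
    fun i => hz ⟨i, rfl⟩
  choose loι hiι gι hlh hhM hg0 hg1 hval hzeq using hdat
  let e : ι ↪ Fin (M + 2) := (Fintype.equivFin ι).toEmbedding.trans (Fin.castLEEmb hcard)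
  have he : Function.Injective e := e.injective
  let w' : Fin (M + 2) → ℝ := Function.extend e w 0
  let g' : Fin (M + 2) → ℝ := Function.extend e gι 0
  let lo' : Fin (M + 2) → ℕ := Function.extend e loι 0
  let hi' : Fin (M + 2) → ℕ := Function.extend e hiι 0
  have hw'on : ∀ i, w' (e i) = w i := fun i => he.extend_apply w 0 i
  have hg'on : ∀ i, g' (e i) = gι i := fun i => he.extend_apply gι 0 i
  have hlo'on : ∀ i, lo' (e i) = loι i := fun i => he.extend_apply loι 0 i
  have hhi'on : ∀ i, hi' (e i) = hiι i := fun i => he.extend_apply hiι 0 i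
  have hw'off : ∀ k, (¬ ∃ i, e i = k) → w' k = 0 := fun k hk => by simp only [w', Function.extend_apply' _ _ _ hk, Pi.zero_apply]
  have hg'off : ∀ k, (¬ ∃ i, e i = k) → g' k = 0 := fun k hk => by simp only [g', Function.extend_apply' _ _ _ hk, Pi.zero_apply]
  have hlo'off : ∀ k, (¬ ∃ i, e i = k) → lo' k = 0 := fun k hk => by simp only [lo', Function.extend_apply' _ _ _ hk, Pi.zero_apply]
  have hhi'off : ∀ k, (¬ ∃ i, e i = k) → hi' k = 0 := fun k hk => by simp only [hi', Function.extend_apply' _ _ _ hk, Pi.zero_apply]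
  have hsumR : ∀ (f : ι → ℝ) (f' : Fin (M + 2) → ℝ), (∀ i, f' (e i) = f i) → (∀ k, (¬ ∃ i, e i = k) → f' k = 0) →
      ∑ k, f' k = ∑ i, f i := by
    intro f f' hon hoff
    rw [← Finset.sum_subset (Finset.subset_univ (Finset.univ.map e)), Finset.sum_map]
    · exact Finset.sum_congr rfl fun i _ => hon i
    · intro k _ hk
      refine hoff k fun ⟨i, hi⟩ => hk ?_
      exact Finset.mem_map.2 ⟨i, Finset.mem_univ _, hi⟩
  have hsumV : ∀ (f : ι → Fin (M + 1) → ℝ) (f' : Fin (M + 2) → Fin (M + 1) → ℝ), (∀ i, f' (e i) = f i) →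
      (∀ k, (¬ ∃ i, e i = k) → f' k = 0) → ∑ k, f' k = ∑ i, f i := by
    intro f f' hon hoff
    rw [← Finset.sum_subset (Finset.subset_univ (Finset.univ.map e)), Finset.sum_map]
    · exact Finset.sum_congr rfl fun i _ => hon i
    · intro k _ hk
      refine hoff k fun ⟨i, hi⟩ => hk ?_
      exact Finset.mem_map.2 ⟨i, Finset.mem_univ _, hi⟩
  refine ⟨w', g', lo', hi', fun k => ?_, ?_, fun k => ?_, fun k => ?_, fun k hk => ?_, ?_⟩
  · by_cases hk : ∃ i, e i = k
    · obtain ⟨i, rfl⟩ := hk; rw [hw'on]; exact (hwpos i).le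
    · rw [hw'off k hk]
  · rw [hsumR w w' hw'on hw'off]; exact hw1
  · by_cases hk : ∃ i, e i = k
    · obtain ⟨i, rfl⟩ := hk; rw [hg'on]; exact ⟨hg0 i, hg1 i⟩
    · rw [hg'off k hk]; exact ⟨le_rfl, zero_le_one⟩
  · by_cases hk : ∃ i, e i = k
    · obtain ⟨i, rfl⟩ := hk; rw [hlo'on, hhi'on]; exact ⟨hlh i, hhM i⟩
    · rw [hlo'off k hk, hhi'off k hk]; exact ⟨le_rfl, Nat.zero_le _⟩
  · by_cases hk' : ∃ i, e i = k
    · obtain ⟨i, rfl⟩ := hk'; rw [hlo'on, hhi'on, hg'on]; exact hval i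
    · exfalso; rw [hw'off k hk'] at hk; exact lt_irrefl _ hk
  · rw [← hwv]
    symm
    refine hsumV (fun i => w i • z i) (fun k => w' k • tpVec M (lo' k) (hi' k) (g' k)) (fun i => ?_) (fun k hk => ?_)
    · rw [hw'on, hlo'on, hhi'on, hg'on, hzeq i]
    · rw [hw'off k hk, zero_smul]

/-- a `Fin (M+2)`-indexed decomposition is a DEC(j′) certificate (for a law vanishing above `M`). [this work] -/
theorem decAtT_of_boundedDecomposition {x T : ℝ} {j' M : ℕ} {μ : ℕ → ℝ} (hμM : ∀ h, M < h → μ h = 0)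
    (w gg : Fin (M + 2) → ℝ) (lo hi : Fin (M + 2) → ℕ)
    (h0 : ∀ r, 0 ≤ w r) (h1 : ∑ r, w r = 1) (hg : ∀ r, 0 ≤ gg r ∧ gg r ≤ 1) (hlh : ∀ r, lo r ≤ hi r ∧ hi r ≤ M)
    (hval : ∀ r, 0 < w r → ValidAt x T j' (lo r) (hi r) (gg r))
    (hv : (fun i : Fin (M + 1) => μ i) = ∑ r, w r • tpVec M (lo r) (hi r) (gg r)) :
    DECAtT x T j' M μ := by
  classical
  refine ⟨Fin (M + 2), inferInstance, w, gg, lo, hi, h0, h1, hg, fun r => (hlh r).1, fun r => (hlh r).2, fun h => ?_, hval⟩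
  by_cases hh : h < M + 1
  · have e1 := congrFun hv ⟨h, hh⟩
    simp only [Finset.sum_apply, Pi.smul_apply, smul_eq_mul, tpVec] at e1
    rw [e1]
  · rw [hμM h (by omega)]
    symm
    refine Finset.sum_eq_zero fun r _ => ?_
    have h1' : (h : ℕ) ≠ hi r := by have := (hlh r).2; omega
    have h2' : (h : ℕ) ≠ lo r := by have := (hlh r).1; have := (hlh r).2; omega
    rw [if_neg h1', if_neg h2']; ring

/-- **DEC(j′) ⟺ a decomposition with at most `M + 2` components.** [this work] -/
theorem decAtT_iff_boundedDecomposition {x T : ℝ} {j' M : ℕ} {μ : ℕ → ℝ} (hμM : ∀ h, M < h → μ h = 0) :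
    DECAtT x T j' M μ ↔ ∃ (w gg : Fin (M + 2) → ℝ) (lo hi : Fin (M + 2) → ℕ),
      (∀ r, 0 ≤ w r) ∧ ∑ r, w r = 1 ∧ (∀ r, 0 ≤ gg r ∧ gg r ≤ 1) ∧ (∀ r, lo r ≤ hi r ∧ hi r ≤ M) ∧
      (∀ r, 0 < w r → ValidAt x T j' (lo r) (hi r) (gg r)) ∧
      (fun i : Fin (M + 1) => μ i) = ∑ r, w r • tpVec M (lo r) (hi r) (gg r) := by
  constructor
  · intro h
    exact exists_boundedDecomposition_of_mem_convexHull (mem_convexHull_validSet_of_decAtT h)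
  · rintro ⟨w, gg, lo, hi, h0, h1, hg, hlh, hval, hv⟩
    exact decAtT_of_boundedDecomposition hμM w gg lo hi h0 h1 hg hlh hval hv

/-! ### The closed graph of DEC(j′) -/

/-- the standard simplex on `Fin n` is a compact space (as a subtype). [folklore] -/
instance compactSpace_stdSimplex_fin (n : ℕ) : CompactSpace (stdSimplex ℝ (Fin n)) :=
  isCompact_iff_compactSpace.mp (isCompact_stdSimplex ℝ (Fin n))

/-- the compact PARAMETER SPACE of bounded decompositions on `{0..M}`: weights in the standard simplex on `M + 2` slots and one gate
in `[0,1]` per slot (the sizes `lo, hi` are handled as a finite union outside). [this work] -/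
abbrev DecParam (M : ℕ) : Type := (stdSimplex ℝ (Fin (M + 2))) × (Fin (M + 2) → unitInterval)

/-- validity in closed form is a closed condition along continuous data. [this work] -/
theorem isClosed_setOf_validC {Z : Type*} [TopologicalSpace Z] {fx fT fg : Z → ℝ} (hx : Continuous fx) (hT : Continuous fT)
    (hg : Continuous fg) (j' lo hi : ℕ) : IsClosed {z | ValidC (fx z) (fT z) j' lo hi (fg z)} := by
  have hk : Continuous fun z => if fx z ≤ fg z then fg z * (1 - fx z) else fg z - fx z ^ 2 :=
    Continuous.if_le (hg.mul (continuous_const.sub hx)) (hg.sub (hx.pow 2)) hx hg (fun z heq => by rw [heq]; ring)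
  unfold ValidC
  simp only [Set.setOf_or, Set.setOf_and]
  refine IsClosed.union (isClosed_const.inter (IsClosed.union (isClosed_le hT continuous_const) isClosed_const))
    (IsClosed.union (isClosed_const.inter (isClosed_const.inter (isClosed_le hx hg)))
      (isClosed_const.inter (isClosed_const.inter (isClosed_le ?_ ?_))))
  · exact (continuous_const.sub hx).mul hT
  · exact ((continuous_const.sub hx).mul continuous_const).add (continuous_const.mul hk)

/-- the closed RELATION "`θ` is a bounded decomposition of the vector `v` at `(x, T)` with size pattern `(lo, hi)`" on
`((x,T), v) × θ`. [this work] -/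
def decLimRel (j' M : ℕ) (lo hi : Fin (M + 2) → Fin (M + 1)) : Set (((ℝ × ℝ) × (Fin (M + 1) → ℝ)) × DecParam M) :=
  {z | (∀ i : Fin (M + 1), z.1.2 i = ∑ r, (z.2.1 : Fin (M + 2) → ℝ) r *
        ((z.2.2 r : ℝ) * (if (i : ℕ) = (hi r : ℕ) then 1 else 0) + (1 - (z.2.2 r : ℝ)) * (if (i : ℕ) = (lo r : ℕ) then 1 else 0))) ∧
      ∀ r, (lo r : ℕ) ≤ hi r ∧ ((z.2.1 : Fin (M + 2) → ℝ) r = 0 ∨ ValidC z.1.1.1 z.1.1.2 j' (lo r) (hi r) (z.2.2 r))}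

/-- **the graph of DEC(j′)** on `{0..M}`: pairs `((x, T), v)` admitting a bounded decomposition in closed form. [this work] -/
def decGraph (j' M : ℕ) : Set ((ℝ × ℝ) × (Fin (M + 1) → ℝ)) :=
  ⋃ lh : (Fin (M + 2) → Fin (M + 1)) × (Fin (M + 2) → Fin (M + 1)), Prod.fst '' decLimRel j' M lh.1 lh.2

/-- the relation is closed. [this work] -/
theorem isClosed_decLimRel (j' M : ℕ) (lo hi : Fin (M + 2) → Fin (M + 1)) : IsClosed (decLimRel j' M lo hi) := by
  -- continuous coordinates
  have cx : Continuous fun z : ((ℝ × ℝ) × (Fin (M + 1) → ℝ)) × DecParam M => z.1.1.1 :=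
    continuous_fst.comp (continuous_fst.comp continuous_fst)
  have cT : Continuous fun z : ((ℝ × ℝ) × (Fin (M + 1) → ℝ)) × DecParam M => z.1.1.2 :=
    continuous_snd.comp (continuous_fst.comp continuous_fst)
  have cv : ∀ i, Continuous fun z : ((ℝ × ℝ) × (Fin (M + 1) → ℝ)) × DecParam M => z.1.2 i :=
    fun i => (continuous_apply i).comp (continuous_snd.comp continuous_fst)
  have cw : ∀ r, Continuous fun z : ((ℝ × ℝ) × (Fin (M + 1) → ℝ)) × DecParam M => (z.2.1 : Fin (M + 2) → ℝ) r :=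
    fun r => (continuous_apply r).comp (continuous_subtype_val.comp (continuous_fst.comp continuous_snd))
  have cg : ∀ r, Continuous fun z : ((ℝ × ℝ) × (Fin (M + 1) → ℝ)) × DecParam M => ((z.2.2 r : unitInterval) : ℝ) :=
    fun r => continuous_subtype_val.comp ((continuous_apply r).comp (continuous_snd.comp continuous_snd))
  have e : decLimRel j' M lo hi =
      (⋂ i : Fin (M + 1), {z | z.1.2 i = ∑ r, (z.2.1 : Fin (M + 2) → ℝ) r *
        ((z.2.2 r : ℝ) * (if (i : ℕ) = (hi r : ℕ) then 1 else 0) + (1 - (z.2.2 r : ℝ)) * (if (i : ℕ) = (lo r : ℕ) then 1 else 0))}) ∩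
      ⋂ r : Fin (M + 2), ({z | (lo r : ℕ) ≤ hi r} ∩ ({z | (z.2.1 : Fin (M + 2) → ℝ) r = 0} ∪
        {z | ValidC z.1.1.1 z.1.1.2 j' (lo r) (hi r) (z.2.2 r)})) := by
    ext z
    simp only [decLimRel, Set.mem_setOf_eq, Set.mem_inter_iff, Set.mem_iInter, Set.mem_union]
  rw [e]
  refine IsClosed.inter (isClosed_iInter fun i => isClosed_eq (cv i) ?_)
    (isClosed_iInter fun r => isClosed_const.inter ((isClosed_eq (cw r) continuous_const).union
      (isClosed_setOf_validC cx cT (cg r) j' (lo r) (hi r))))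
  refine continuous_finsetSum _ fun r _ => (cw r).mul ?_
  exact ((cg r).mul continuous_const).add ((continuous_const.sub (cg r)).mul continuous_const)

/-- **the graph of DEC(j′) is closed** (projection of a closed relation along a compact factor; finitely many size patterns). [this work] -/
theorem isClosed_decGraph (j' M : ℕ) : IsClosed (decGraph j' M) := by
  refine isClosed_iUnion_of_finite fun lh => ?_
  exact isClosedMap_fst_of_compactSpace _ (isClosed_decLimRel j' M lh.1 lh.2)

/-- a DEC(j′) law (floor `x < 1`, vanishing above `M`) lies on the graph. [this work] -/
theorem mem_decGraph_of_decAtT {x T : ℝ} {j' M : ℕ} {μ : ℕ → ℝ} (hx1 : x < 1) (hμM : ∀ h, M < h → μ h = 0)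
    (h : DECAtT x T j' M μ) : ((x, T), fun i : Fin (M + 1) => μ i) ∈ decGraph j' M := by
  obtain ⟨w, gg, lo, hi, h0, h1, hg, hlh, hval, hv⟩ := (decAtT_iff_boundedDecomposition hμM).1 h
  let θ : DecParam M := ⟨⟨w, ⟨h0, h1⟩⟩, fun r => ⟨gg r, ⟨(hg r).1, (hg r).2⟩⟩⟩
  let lo' : Fin (M + 2) → Fin (M + 1) := fun r => ⟨lo r, by have := (hlh r).1; have := (hlh r).2; omega⟩
  let hi' : Fin (M + 2) → Fin (M + 1) := fun r => ⟨hi r, by have := (hlh r).2; omega⟩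
  refine Set.mem_iUnion.2 ⟨(lo', hi'), ⟨(((x, T), fun i : Fin (M + 1) => μ i), θ), ⟨fun i => ?_, fun r => ⟨(hlh r).1, ?_⟩⟩, rfl⟩⟩
  · have e1 := congrFun hv i
    simp only [Finset.sum_apply, Pi.smul_apply, smul_eq_mul, tpVec] at e1
    exact e1
  · by_cases hr : w r = 0
    · exact Or.inl hr
    · exact Or.inr ((validC_iff hx1).2 (hval r (lt_of_le_of_ne (h0 r) (Ne.symm hr))))

/-- a point of the graph (floor `x < 1`) is a DEC(j′) law. [this work] -/
theorem decAtT_of_mem_decGraph {x T : ℝ} {j' M : ℕ} {μ : ℕ → ℝ} (hx1 : x < 1) (hμM : ∀ h, M < h → μ h = 0)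
    (h : ((x, T), fun i : Fin (M + 1) => μ i) ∈ decGraph j' M) : DECAtT x T j' M μ := by
  obtain ⟨lh, z, hz, hz1⟩ := Set.mem_iUnion.1 h
  obtain ⟨heq, hr⟩ := hz
  have zx : z.1.1.1 = x := by rw [hz1]
  have zT : z.1.1.2 = T := by rw [hz1]
  have zv : ∀ i : Fin (M + 1), z.1.2 i = μ i := fun i => by rw [hz1]
  refine decAtT_of_boundedDecomposition hμM (z.2.1 : Fin (M + 2) → ℝ) (fun r => (z.2.2 r : ℝ)) (fun r => (lh.1 r : ℕ))
    (fun r => (lh.2 r : ℕ)) (fun r => z.2.1.2.1 r) z.2.1.2.2 (fun r => ⟨(z.2.2 r).2.1, (z.2.2 r).2.2⟩)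
    (fun r => ⟨(hr r).1, Nat.lt_succ_iff.mp (lh.2 r).isLt⟩) (fun r hwr => ?_) ?_
  · rcases (hr r).2 with h0 | hV
    · exfalso; rw [h0] at hwr; exact lt_irrefl _ hwr
    · rw [zx, zT] at hV; exact (validC_iff hx1).1 hV
  · funext i
    rw [← zv i, heq i, Finset.sum_apply]
    refine Finset.sum_congr rfl fun r _ => ?_
    simp only [Pi.smul_apply, smul_eq_mul, tpVec]

/-! ### Limits -/

/-- **DEC(j′) PASSES TO LIMITS**: floors `xₙ → x < 1` (`xₙ < 1`), targets `Tₙ → T`, laws `μₙ → μ` pointwise, all vanishing above `M`;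
if every `μₙ` is DEC(j′) at `(xₙ, Tₙ)` then `μ` is DEC(j′) at `(x, T)`. [this work] -/
theorem decAtT_of_tendsto {x T : ℝ} {j' M : ℕ} {μ : ℕ → ℝ} {xs Ts : ℕ → ℝ} {μs : ℕ → ℕ → ℝ}
    (hx : Tendsto xs atTop (𝓝 x)) (hT : Tendsto Ts atTop (𝓝 T)) (hμ : ∀ h, Tendsto (fun n => μs n h) atTop (𝓝 (μ h)))
    (hxs1 : ∀ n, xs n < 1) (hx1 : x < 1) (hμsM : ∀ n h, M < h → μs n h = 0) (hμM : ∀ h, M < h → μ h = 0)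
    (hdec : ∀ n, DECAtT (xs n) (Ts n) j' M (μs n)) : DECAtT x T j' M μ := by
  have htend : Tendsto (fun n => ((xs n, Ts n), fun i : Fin (M + 1) => μs n i)) atTop
      (𝓝 ((x, T), fun i : Fin (M + 1) => μ i)) :=
    (hx.prodMk_nhds hT).prodMk_nhds (tendsto_pi_nhds.2 fun i => hμ i)
  have hmem : ((x, T), fun i : Fin (M + 1) => μ i) ∈ decGraph j' M :=
    (isClosed_decGraph j' M).mem_of_tendsto htend (Eventually.of_forall fun n => mem_decGraph_of_decAtT (hxs1 n) (hμsM n) (hdec n))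
  exact decAtT_of_mem_decGraph hx1 hμM hmem

/-- **DEC(j′) AT THE LAW'S OWN MEAN PASSES TO LIMITS.** [this work] -/
theorem decAt_of_tendsto {x : ℝ} {j' M : ℕ} {μ : ℕ → ℝ} {xs : ℕ → ℝ} {μs : ℕ → ℕ → ℝ}
    (hx : Tendsto xs atTop (𝓝 x)) (hμ : ∀ h, Tendsto (fun n => μs n h) atTop (𝓝 (μ h)))
    (hxs1 : ∀ n, xs n < 1) (hx1 : x < 1) (hμsM : ∀ n h, M < h → μs n h = 0) (hμM : ∀ h, M < h → μ h = 0)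
    (hdec : ∀ n, DECAt (xs n) j' M (μs n)) : DECAt x j' M μ := by
  rw [decAt_iff_decAtT]
  refine decAtT_of_tendsto hx ?_ hμ hxs1 hx1 hμsM hμM (fun n => (decAt_iff_decAtT _ _ _ _).1 (hdec n))
  exact tendsto_finsetSum _ fun h _ => (hμ h).const_mul _

/-- **SDEC PASSES TO LIMITS**: floors `0 ≤ xₙ < 1`, `xₙ → x < 1`, laws `μₙ → μ` pointwise vanishing above `M`, every `μₙ` SDEC at `xₙ`
⟹ `μ` is SDEC at `x`.  Consequently, in an induction step whose data depend continuously on the gate parameters of a fixed forest shape it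
suffices to treat a DENSE set of parameters (the genericity principle, README V402). [this work] -/
theorem sdec_of_tendsto {x : ℝ} {M : ℕ} {μ : ℕ → ℝ} {xs : ℕ → ℝ} {μs : ℕ → ℕ → ℝ}
    (hx : Tendsto xs atTop (𝓝 x)) (hμ : ∀ h, Tendsto (fun n => μs n h) atTop (𝓝 (μ h)))
    (hxs0 : ∀ n, 0 ≤ xs n) (hxs1 : ∀ n, xs n < 1) (hx1 : x < 1)
    (hμsM : ∀ n h, M < h → μs n h = 0) (hμM : ∀ h, M < h → μ h = 0)
    (hS : ∀ n, SDEC (xs n) M (μs n)) : SDEC x M μ := by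
  intro q hq0 hq1 j' hj'
  have hgate : ∀ h, Tendsto (fun n => gate (μs n) q h) atTop (𝓝 (gate μ q h)) := fun h => by
    simp only [gate]
    exact ((hμ h).const_mul q).add tendsto_const_nhds
  have hgM : ∀ (ν : ℕ → ℝ), (∀ h, M < h → ν h = 0) → ∀ h, M < h → gate ν q h = 0 := fun ν hν h hh => by
    simp only [gate]; rw [hν h hh, if_neg (by omega)]; ring
  have hqx : ∀ n, q * xs n < 1 := fun n => by
    calc q * xs n ≤ 1 * xs n := mul_le_mul_of_nonneg_right hq1 (hxs0 n)
      _ < 1 := by rw [one_mul]; exact hxs1 n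
  have hqx1 : q * x < 1 := by
    by_cases hx0 : 0 ≤ x
    · calc q * x ≤ 1 * x := mul_le_mul_of_nonneg_right hq1 hx0
        _ < 1 := by rw [one_mul]; exact hx1
    · have : q * x < 0 := mul_neg_of_pos_of_neg hq0 (lt_of_not_ge hx0)
      linarith
  exact decAt_of_tendsto (hx.const_mul q) hgate hqx hqx1 (fun n => hgM (μs n) (hμsM n)) (hgM μ hμM)
    (fun n => hS n q hq0 hq1 j' hj')

/-- **THE SUPREMUM FLOOR IS ATTAINED**: if `μ` (vanishing above `M`) is SDEC at every floor `x′ < x` with `0 < x < 1`, it is SDEC at `x`. [this work] -/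
theorem sdec_of_forall_lt {x : ℝ} {M : ℕ} {μ : ℕ → ℝ} (hx0 : 0 < x) (hx1 : x < 1) (hμM : ∀ h, M < h → μ h = 0)
    (h : ∀ x', 0 < x' → x' < x → SDEC x' M μ) : SDEC x M μ := by
  -- floors `x·(1 − 1/(n+2)) ↑ x`
  have ht : Tendsto (fun n : ℕ => x * (1 - 1 / ((n : ℝ) + 2))) atTop (𝓝 x) := by
    have h1 : Tendsto (fun n : ℕ => 1 / ((n : ℝ) + 2)) atTop (𝓝 0) := by
      have := tendsto_one_div_add_atTop_nhds_zero_nat (𝕜 := ℝ)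
      have e : (fun n : ℕ => 1 / ((n : ℝ) + 2)) = fun n : ℕ => 1 / (((n + 1 : ℕ) : ℝ) + 1) := by
        funext n; push_cast; ring_nf
      rw [e]
      exact this.comp (tendsto_add_atTop_nat 1)
    have h2 : Tendsto (fun n : ℕ => x * (1 - 1 / ((n : ℝ) + 2))) atTop (𝓝 (x * (1 - 0))) :=
      (tendsto_const_nhds.sub h1).const_mul x
    rw [sub_zero, mul_one] at h2
    exact h2
  refine sdec_of_tendsto ht (fun h => tendsto_const_nhds) (fun n => ?_) (fun n => ?_) hx1 (fun _ => hμM) hμM (fun n => h _ ?_ ?_)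
  · have : 0 ≤ 1 - 1 / ((n : ℝ) + 2) := by
      rw [sub_nonneg, div_le_one (by positivity)]; linarith
    positivity
  · have : 1 - 1 / ((n : ℝ) + 2) < 1 := by
      have : 0 < 1 / ((n : ℝ) + 2) := by positivity
      linarith
    calc x * (1 - 1 / ((n : ℝ) + 2)) < x * 1 := mul_lt_mul_of_pos_left this hx0
      _ < 1 := by rw [mul_one]; exact hx1
  · have : 0 < 1 - 1 / ((n : ℝ) + 2) := by
      rw [sub_pos, div_lt_one (by positivity)]; linarith
    positivity
  · have : 1 - 1 / ((n : ℝ) + 2) < 1 := by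
      have : 0 < 1 / ((n : ℝ) + 2) := by positivity
      linarith
    calc x * (1 - 1 / ((n : ℝ) + 2)) < x * 1 := mul_lt_mul_of_pos_left this hx0
      _ = x := mul_one x

end LawDec

end Quant

end Summit.CriticalPhenomena.PercolationContinuityZ3.Theorems
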